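import Mathlib
import Summits.CriticalPhenomena.CardyFormulaZ2.Theorems.CardyMagicRigidityDefs
import Summits.CriticalPhenomena.CardyFormulaZ2.Theorems.CardyMagicRigidityPositiveConeDefs
import Summits.CriticalPhenomena.CardyFormulaZ2.Theorems.CardyMagicRigidityNestingRigidityPrecompactnessLimitSamples
import Summits.CriticalPhenomena.CardyFormulaZ2.Theorems.CardyMagicRigidityNestingRigidityPatternCountStability
import Summits.CriticalPhenomena.CardyFormulaZ2.Theorems.CardyMagicRigidityNestingRigidityBigLoopsFirstMoment
import Literature.Probability.RandomPlanarGeometry.LocFinLoopConfig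
import HarnessLib

/-!
# Stub `stub_precompactness`, regular limits: a.e. sample of a `d_CN`-limit law of a lattice ensemble is locally finite

Crux `Summit.CriticalPhenomena.CardyFormulaZ2.Theses.CardyMagicRigidity.NestingRigidity`
(stmt-CriticalPhenomena-4835), line `positive-cone-weight-doubling`, registered stub `stub_precompactness :
PrecompactRegular zEns ∧ PrecompactRegular tEns`.  Third field of `Regular` for LIMIT configurations (after
`degreeOne`, `laminar`: `…PrecompactnessRegularLimit` p128987, `…PrecompactnessLimitSamples` p129158):
**local finiteness** (`LoopConfig.IsLocallyFinite`: finitely many loops of each type of diameter `≥ ε` inside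
every window) holds almost surely for EVERY presentation `X` (finite measure space, measurable exceptional events)
of a sequential `d_CN`-limit of the laws of a lattice ensemble `E ∈ latticeEnsembles` — from the tree's uniform
first-moment bound K1 (`integral_ncard_bigLoops_le`, p125372: `E[#{loops in B(0,R), diam ≥ η}] ≤ C (R/η)²` for
`c₀ δ ≤ η ≤ R`), with no modification of the presentation:

* `Precompact.ncard_le_ncard_bigLoops_of_isClose` — DETERMINISTIC: if `d_CN(c, x) ≤ ε` (printed relation) then a
  finite family of loops of `x` inside `B(0, R)`, `R ≤ 1/ε`, of diameter `≥ η` and pairwise `> 2ε` apart in DKKMO's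
  loop distance injects (partner map) into the loops of `c` inside `B(0, R + ε)` of diameter `≥ η − 2ε`
  (`UnbasedLoop.range_subset_ball_of_udist_le`, `UnbasedLoop.diam_range_le_of_udist_le`, `udist_triangle`);
* `Precompact.exists_reversalFree_subset`, `Precompact.exists_separated_of_infinite` — COMBINATORIAL: a finite
  family of `2M` loops contains `M` loops no two of which are time reversals of each other (peel off
  `{u, u.reverse}`), hence (`exists_pairwise_lt_udist`, p-landed in `…PatternCountStability`) an infinite family
  contains, for every `M`, `M` loops pairwise `θ`-separated for some `θ > 0`;
* `Precompact.measure_separated_le` — PROBABILISTIC KEY BOUND: for `θ > 0` and `M ≥ 1`, the set of `s` such that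
  `X s` has `M` pairwise `θ`-separated loops of type `i` inside `B(0, R)` of diameter `≥ η` has `ν`-measure
  `≤ K/M`, `K = 2 C ((R+1)/(η/2))²`: couple at a scale `ε ≪ θ, η` (`LoopConfig.exists_coupling_of_cnLawEDist_lt`),
  inject into the lattice big loops off the exceptional event, Markov with K1 on the lattice side, and the
  co-projection bound `Precompact.exists_measurableSet_superset_forall_section` (p129158) to come back to `s`;
* `ae_isLocallyFinite_of_tendsto_cnLawEDist` (registered anchor) — hence `ν`-a.e. `X s` is locally finite
  (continuity from below over `θ ↓ 0`, `Monotone.measure_iUnion`, then `M → ∞`; integer windows and diameters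
  suffice).

Consequently three of the five fields of `Regular` (`degreeOne`, `laminar`, `locallyFinite`) hold a.s. for every
`d_CN`-limit presentation with measurable exceptional events; `boundary` and `separating` remain (they need
uniform lattice estimates beyond first moments: no retraced arcs, no two macroscopic interfaces everywhere close).
-/

noncomputable section

open MeasureTheory ProbabilityTheory Set Filter Metric
open scoped Real Topology BigOperators ENNReal

namespace Summit.CriticalPhenomena.CardyFormulaZ2.Cruxes.NestingRigidity.PositiveConeWeightDoubling

open Literature.Probability.RandomPlanarGeometry Literature.Probability.Percolation
  Literature.Probability.LatticeModels
open Summit.CriticalPhenomena.CardyFormulaZ2.Theses.CardyMagicRigidity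
open Summit.CriticalPhenomena.CardyFormulaZ2.Cruxes.NestingRigidity.RingCloudTomography

namespace Precompact

/-! ### A. Separated big loops of the limit inject into big loops of a close configuration -/

/-- **Partner injection.**  If `d_CN(c, x) ≤ ε` (printed relation), a family `F` of loops of type `i` of `x`
inside `B(0, R)`, `R ≤ 1/ε`, of diameter `≥ η`, pairwise `> 2ε` apart in `udist`, has at most as many members as
there are loops of `c` inside `B(0, R + ε)` of diameter `≥ η − 2ε` (when the latter set is finite): the partner
map is injective by the triangle inequality for `udist`. -/
theorem ncard_le_ncard_bigLoops_of_isClose {c x : LoopConfig ℂ} {ε R η : ℝ} (hRε : R ≤ 1 / ε)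
    (hclose : LoopConfig.IsClose ε c x) (i : Fin 2) {F : Set (UnbasedLoop ℂ)}
    (hF : F ⊆ {u ∈ x.F i | u.range ⊆ ball (0 : ℂ) R ∧ η ≤ diam u.range})
    (hsep : F.Pairwise fun u v ↦ 2 * ε < u.udist v)
    (hfin : {v ∈ c.loops | v.range ⊆ ball (0 : ℂ) (R + ε) ∧ η - 2 * ε ≤ diam v.range}.Finite) :
    F.ncard ≤ {v ∈ c.loops | v.range ⊆ ball (0 : ℂ) (R + ε) ∧ η - 2 * ε ≤ diam v.range}.ncard := by
  classical
  have hp : ∀ u ∈ F, ∃ u' ∈ c.F i, u.udist u' ≤ ε := fun u hu ↦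
    (hclose i).2 u (hF hu).1 ((hF hu).2.1.trans (ball_subset_ball hRε))
  set p : UnbasedLoop ℂ → UnbasedLoop ℂ := fun u ↦ if hu : u ∈ F then (hp u hu).choose else u with hpdef
  have hpF : ∀ u ∈ F, p u ∈ c.F i ∧ u.udist (p u) ≤ ε := fun u hu ↦ by
    simp only [hpdef, dif_pos hu]
    exact (hp u hu).choose_spec
  refine Set.ncard_le_ncard_of_injOn p (fun u hu ↦ ?_) (fun u hu v hv huv ↦ ?_) hfin
  · obtain ⟨hpu, hdu⟩ := hpF u hu
    refine ⟨c.subset_loops i hpu, UnbasedLoop.range_subset_ball_of_udist_le (hF hu).2.1 hdu, ?_⟩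
    have := UnbasedLoop.diam_range_le_of_udist_le u (p u) hdu
    linarith [(hF hu).2.2]
  · by_contra hne
    have h2 : (p u).udist v ≤ ε := by
      rw [huv, UnbasedLoop.udist_comm]
      exact (hpF v hv).2
    have hle : u.udist v ≤ 2 * ε :=
      calc u.udist v ≤ u.udist (p u) + (p u).udist v := UnbasedLoop.udist_triangle _ _ _
        _ ≤ ε + ε := add_le_add (hpF u hu).2 h2
        _ = 2 * ε := by ring
    exact (not_lt.2 hle) (hsep hu hv hne)

/-! ### B. Reversal-free and separated subfamilies -/

/-- A pair `{u, u.reverse}` has at most two members. -/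
theorem ncard_pair_reverse_le (u : UnbasedLoop ℂ) : ({u, u.reverse} : Set (UnbasedLoop ℂ)).ncard ≤ 2 := by
  calc ({u, u.reverse} : Set (UnbasedLoop ℂ)).ncard ≤ ({u.reverse} : Set (UnbasedLoop ℂ)).ncard + 1 :=
        Set.ncard_insert_le _ _
    _ = 2 := by rw [Set.ncard_singleton]

/-- **Reversal-free subfamilies.**  A finite family of at least `2M` loops contains `M` loops no two of which are
time reversals of each other (peel off the pair `{u, u.reverse}` of a member and recurse). -/
theorem exists_reversalFree_subset : ∀ (M : ℕ) (A : Set (UnbasedLoop ℂ)), A.Finite → 2 * M ≤ A.ncard →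
    ∃ F ⊆ A, M ≤ F.ncard ∧ F.Pairwise fun u v ↦ v ≠ u.reverse
  | 0, A, _, _ => ⟨∅, empty_subset _, by simp, by simp⟩
  | M + 1, A, hA, hM => by
      have hpos : 0 < A.ncard := by omega
      obtain ⟨u, hu⟩ := (Set.ncard_pos hA).1 hpos
      set A' : Set (UnbasedLoop ℂ) := A \ {u, u.reverse} with hA'def
      have hA' : A'.Finite := hA.sdiff
      have hcard : 2 * M ≤ A'.ncard := by
        have h1 : A.ncard ≤ A'.ncard + ({u, u.reverse} : Set (UnbasedLoop ℂ)).ncard :=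
          Set.ncard_le_ncard_sdiff_add_ncard A {u, u.reverse}
        have h2 := ncard_pair_reverse_le u
        omega
      obtain ⟨F', hF'A', hMF', hF'rev⟩ := exists_reversalFree_subset M A' hA' hcard
      have huF' : u ∉ F' := fun h ↦ (hF'A' h).2 (by simp)
      refine ⟨insert u F', Set.insert_subset hu (hF'A'.trans Set.sdiff_subset), ?_, ?_⟩
      · rw [Set.ncard_insert_of_notMem huF' (hA'.subset hF'A')]
        omega
      · rw [Set.pairwise_insert]
        refine ⟨hF'rev, fun v hv _ ↦ ⟨fun h ↦ (hF'A' hv).2 (by simp [h]), fun h ↦ (hF'A' hv).2 ?_⟩⟩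
        have : v = u.reverse := by rw [h, UnbasedLoop.reverse_reverse]
        simp [this]

/-- **An infinite family of loops contains, for every `M`, `M` members pairwise `θ`-separated in `udist` for some
`θ > 0`** (`2M` distinct members, a reversal-free half, `exists_pairwise_lt_udist`). -/
theorem exists_separated_of_infinite {A : Set (UnbasedLoop ℂ)} (hA : A.Infinite) (M : ℕ) :
    ∃ θ : ℝ, 0 < θ ∧ ∃ F ⊆ A, F.Finite ∧ M ≤ F.ncard ∧ F.Pairwise fun u v ↦ θ < u.udist v := by
  obtain ⟨A₀, hA₀A, hA₀fin, hA₀card⟩ := hA.exists_subset_ncard_eq (2 * M)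
  obtain ⟨F, hFA₀, hMF, hrev⟩ := exists_reversalFree_subset M A₀ hA₀fin hA₀card.ge
  obtain ⟨θ, hθ, hsep⟩ := exists_pairwise_lt_udist (hA₀fin.subset hFA₀) hrev
  exact ⟨θ, hθ, F, hFA₀.trans hA₀A, hA₀fin.subset hFA₀, hMF, hsep⟩

/-! ### C. The key probabilistic bound -/

section Key

variable {E : LoopEnsemble} {Ω' : Type*} [MeasurableSpace Ω']

/-- **Key bound.**  Let `E ∈ latticeEnsembles`, `δₖ → 0⁺`, `X` a presentation of a `d_CN`-limit of the laws of
`E.X δₖ` on a finite measure space `(Ω', ν)` with measurable exceptional events, `i` a type, `R ≥ 0` a window,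
`0 < η ≤ 1` a diameter, `θ > 0` a separation and `M ≥ 1`.  Then the set of `s` such that `X s` has `M` loops of
type `i` inside `B(0, R)` of diameter `≥ η` pairwise `θ`-separated has `ν`-measure `≤ 2 C ((R+1)/(η/2))² / M`, `C`
the constant of K1 for `E`.  Proof: for small `ε` couple `E.X δₖ` and `X` with exceptional probability `< ε`; off
the exceptional event the `M` loops inject into the lattice loops inside `B(0, R+1)` of diameter `≥ η/2`
(`ncard_le_ncard_bigLoops_of_isClose`), an event of probability `≤ C((R+1)/(η/2))²/M` (K1 + Markov); the
co-projection bound transfers `2 (ε + C(…)²/M)` to the `s`-side; let `ε → 0`. -/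
theorem measure_separated_le (hE : E ∈ latticeEnsembles) {δs : ℕ → ℝ} (hδs : Tendsto δs atTop (𝓝[>] (0 : ℝ)))
    (ν : Measure Ω') [IsFiniteMeasure ν] {X : Ω' → LoopConfig ℂ}
    (hm : ∀ (k : ℕ) (ε : ℝ), MeasurableSet {p : E.Ω × Ω' | LoopConfig.IsClose ε (E.X (δs k) p.1) (X p.2)})
    (h : Tendsto (fun k : ℕ ↦ LoopConfig.cnLawEDist E.P (E.X (δs k)) ν X) atTop (𝓝 0))
    {C c₀ : ℝ} (hC : 0 < C) (hc₀ : 0 < c₀)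
    (hK1 : ∀ (R η δ : ℝ), 0 < δ → c₀ * δ ≤ η → η ≤ R →
      Integrable (fun ω ↦ ({u ∈ (E.X δ ω).loops | u.range ⊆ ball (0 : ℂ) R ∧ η ≤ diam u.range}.ncard : ℝ)) E.P ∧
      ∫ ω, ({u ∈ (E.X δ ω).loops | u.range ⊆ ball (0 : ℂ) R ∧ η ≤ diam u.range}.ncard : ℝ) ∂E.P ≤
        C * (R / η) ^ 2)
    (i : Fin 2) {R η θ : ℝ} (hR : 0 ≤ R) (hη : 0 < η) (hη1 : η ≤ 1) (hθ : 0 < θ) {M : ℕ} (hM : 1 ≤ M) :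
    ν {s | ∃ F ⊆ {u ∈ (X s).F i | u.range ⊆ ball (0 : ℂ) R ∧ η ≤ diam u.range}, F.Finite ∧ M ≤ F.ncard ∧
        F.Pairwise fun u v ↦ θ < u.udist v} ≤
      ENNReal.ofReal (2 * (C * ((R + 1) / (η / 2)) ^ 2 / M)) := by
  obtain ⟨hSB, hne⟩ := standardBorelSpace_nonempty_of_mem hE
  haveI := hSB; haveI := hne
  haveI : IsProbabilityMeasure E.P := isProbabilityMeasure_of_mem hE
  set S := {s | ∃ F ⊆ {u ∈ (X s).F i | u.range ⊆ ball (0 : ℂ) R ∧ η ≤ diam u.range}, F.Finite ∧ M ≤ F.ncard ∧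
      F.Pairwise fun u v ↦ θ < u.udist v} with hSdef
  set K₁ : ℝ := C * ((R + 1) / (η / 2)) ^ 2 / M with hK₁
  have hK₁nn : 0 ≤ K₁ := by positivity
  have hMpos : (0 : ℝ) < M := by exact_mod_cast hM
  -- it suffices to prove the bound up to `2ε` for every small `ε > 0`
  suffices key : ∀ ε : ℝ, 0 < ε → ε ≤ θ / 4 → ε ≤ η / 4 → ε ≤ 1 / (R + 1) →
      ν S ≤ 2 * ENNReal.ofReal ε + ENNReal.ofReal (2 * K₁) by
    refine ENNReal.le_of_forall_pos_le_add fun κ hκ _ ↦ ?_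
    set ε : ℝ := min (min (θ / 4) (η / 4)) (min (1 / (R + 1)) (κ / 2)) with hεdef
    have hκ' : (0 : ℝ) < κ := hκ
    have hε0 : 0 < ε := by positivity
    have hb := key ε hε0 ((min_le_left _ _).trans (min_le_left _ _)) ((min_le_left _ _).trans (min_le_right _ _))
      ((min_le_right _ _).trans (min_le_left _ _))
    have hεκ : 2 * ENNReal.ofReal ε ≤ (κ : ℝ≥0∞) := by
      have hεκ2 : ε ≤ κ / 2 := (min_le_right _ _).trans (min_le_right _ _)
      have h2ε : 2 * ε ≤ κ := by linarith
      rw [show (2 : ℝ≥0∞) * ENNReal.ofReal ε = ENNReal.ofReal (2 * ε) by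
        rw [ENNReal.ofReal_mul (by norm_num), ENNReal.ofReal_ofNat], ← ENNReal.ofReal_coe_nnreal]
      exact ENNReal.ofReal_le_ofReal h2ε
    calc ν S ≤ 2 * ENNReal.ofReal ε + ENNReal.ofReal (2 * K₁) := hb
      _ ≤ κ + ENNReal.ofReal (2 * K₁) := add_le_add hεκ le_rfl
      _ = ENNReal.ofReal (2 * K₁) + κ := add_comm _ _
  intro ε hε hεθ hεη hεR
  have hε1 : ε ≤ 1 := hεR.trans (by rw [div_le_one (by linarith)]; linarith)
  have hRε : R ≤ 1 / ε := by
    rw [le_one_div hε (by linarith : (0 : ℝ) < R + 1)] at hεR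
    linarith
  -- a good index `k`: positive small mesh and `d_CN < ε`
  have hev₁ : ∀ᶠ k in atTop, δs k ∈ Set.Ioo (0 : ℝ) (η / (2 * c₀)) :=
    hδs.eventually (Ioo_mem_nhdsGT (by positivity))
  have hev₂ : ∀ᶠ k in atTop, LoopConfig.cnLawEDist E.P (E.X (δs k)) ν X < ENNReal.ofReal ε :=
    h (Iio_mem_nhds (ENNReal.ofReal_pos.2 hε))
  obtain ⟨k, ⟨hδpos, hδlt⟩, hk⟩ := (hev₁.and hev₂).exists
  have hc₀δ : c₀ * δs k ≤ η / 2 := by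
    rw [lt_div_iff₀ (by positivity)] at hδlt
    linarith
  -- K1 on the lattice side at window `R + 1`, diameter `η / 2`
  obtain ⟨hint, hmean⟩ := hK1 (R + 1) (η / 2) (δs k) hδpos hc₀δ (by linarith)
  set G : Set E.Ω := {ω | (M : ℝ) ≤
    ({u ∈ (E.X (δs k) ω).loops | u.range ⊆ ball (0 : ℂ) (R + 1) ∧ η / 2 ≤ diam u.range}.ncard : ℝ)} with hG
  have hGm : MeasurableSet G :=
    measurableSet_le measurable_const (measurable_from_nat.comp
      (BigLoops.measurable_ncard_loops_sep E hE (δs k) fun u ↦ u.range ⊆ ball (0 : ℂ) (R + 1) ∧ η / 2 ≤ diam u.range))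
  have hGle : E.P G ≤ ENNReal.ofReal K₁ := by
    have hmk := mul_meas_ge_le_integral_of_nonneg (Eventually.of_forall fun ω ↦ by positivity) hint (M : ℝ)
    have hreal : E.P.real G ≤ K₁ := by
      rw [hK₁, le_div_iff₀ hMpos]
      calc E.P.real G * M = M * E.P.real G := mul_comm _ _
        _ ≤ _ := hmk
        _ ≤ C * ((R + 1) / (η / 2)) ^ 2 := hmean
    rw [← ENNReal.ofReal_toReal (measure_ne_top E.P G)]
    exact ENNReal.ofReal_le_ofReal hreal
  -- the coupling and the bad event
  obtain ⟨P, hP₁, hP₂, hP₃⟩ := LoopConfig.exists_coupling_of_cnLawEDist_lt hk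
  haveI : IsFiniteMeasure P := ⟨by
    rw [← Set.preimage_univ (f := (Prod.snd : E.Ω × Ω' → Ω')),
      ← Measure.map_apply measurable_snd MeasurableSet.univ, hP₂]
    exact measure_lt_top ν univ⟩
  set B : Set (E.Ω × Ω') := {p | ¬ LoopConfig.IsClose ε (E.X (δs k) p.1) (X p.2)} ∪ Prod.fst ⁻¹' G with hB
  have hBm : MeasurableSet B := (hm k ε).compl.union (measurable_fst hGm)
  -- finiteness of the lattice big-loop sets
  obtain ⟨N, hN⟩ := BigLoops.exists_ncard_loops_sep_le E hE hδpos (R + 1)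
  -- `S` forces the whole fibre into `B`
  have hSB : S ⊆ {s | ∀ ω, (ω, s) ∈ B} := by
    intro s hs ω
    by_cases hcl : LoopConfig.IsClose ε (E.X (δs k) ω) (X s)
    · right
      obtain ⟨F, hF, hFfin, hMF, hsep⟩ := hs
      have hfin₁ : {v ∈ (E.X (δs k) ω).loops | v.range ⊆ ball (0 : ℂ) (R + ε) ∧ η - 2 * ε ≤ diam v.range}.Finite :=
        (hN (fun v ↦ v.range ⊆ ball (0 : ℂ) (R + ε) ∧ η - 2 * ε ≤ diam v.range)
          (fun v hv ↦ hv.1.trans (ball_subset_ball (by linarith))) ω).1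
      have hfin₂ : {v ∈ (E.X (δs k) ω).loops | v.range ⊆ ball (0 : ℂ) (R + 1) ∧ η / 2 ≤ diam v.range}.Finite :=
        (hN (fun v ↦ v.range ⊆ ball (0 : ℂ) (R + 1) ∧ η / 2 ≤ diam v.range) (fun v hv ↦ hv.1) ω).1
      have h₁ := ncard_le_ncard_bigLoops_of_isClose hRε hcl i hF
        (hsep.mono' fun u v huv ↦ by linarith) hfin₁
      have h₂ : {v ∈ (E.X (δs k) ω).loops | v.range ⊆ ball (0 : ℂ) (R + ε) ∧ η - 2 * ε ≤ diam v.range}.ncard ≤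
          {v ∈ (E.X (δs k) ω).loops | v.range ⊆ ball (0 : ℂ) (R + 1) ∧ η / 2 ≤ diam v.range}.ncard :=
        ncard_le_ncard (fun v hv ↦ ⟨hv.1, hv.2.1.trans (ball_subset_ball (by linarith)), by linarith [hv.2.2]⟩)
          hfin₂
      show (M : ℝ) ≤ ({u ∈ (E.X (δs k) ω).loops | u.range ⊆ ball (0 : ℂ) (R + 1) ∧ η / 2 ≤ diam u.range}.ncard : ℝ)
      exact_mod_cast hMF.trans (h₁.trans h₂)
    · exact Or.inl hcl
  -- co-projection and the final count
  obtain ⟨T, -, hTsub, hTle⟩ := exists_measurableSet_superset_forall_section P hBm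
  rw [hP₂] at hTle
  have hPG : P (Prod.fst ⁻¹' G) = E.P G := by rw [← Measure.map_apply measurable_fst hGm, hP₁]
  calc ν S ≤ ν T := measure_mono (hSB.trans hTsub)
    _ ≤ 2 * P B := hTle
    _ ≤ 2 * (ENNReal.ofReal ε + ENNReal.ofReal K₁) := by
        gcongr 2 * ?_
        exact (measure_union_le _ _).trans (add_le_add hP₃.le (by rw [hPG]; exact hGle))
    _ = 2 * ENNReal.ofReal ε + ENNReal.ofReal (2 * K₁) := by
        rw [mul_add, ENNReal.ofReal_mul (by norm_num : (0 : ℝ) ≤ 2), ENNReal.ofReal_ofNat]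

end Key

/-! ### D. Almost sure local finiteness -/

/-- Integer windows and diameters suffice for local finiteness. -/
theorem isLocallyFinite_of_nat {c : LoopConfig ℂ}
    (h : ∀ (i : Fin 2) (N n : ℕ),
      {u ∈ c.F i | u.range ⊆ ball (0 : ℂ) N ∧ (1 : ℝ) / (n + 1) ≤ diam u.range}.Finite) :
    c.IsLocallyFinite := by
  intro i r ε hε
  obtain ⟨N, hN⟩ := exists_nat_ge r
  obtain ⟨n, hn⟩ := exists_nat_one_div_lt hε
  exact (h i N n).subset fun u hu ↦ ⟨hu.1, hu.2.1.trans (ball_subset_ball hN), hn.le.trans hu.2.2⟩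

end Precompact

open Precompact in
/-- **A.e. sample of a `d_CN`-limit law of a lattice ensemble is locally finite (registered anchor).**  Let
`E ∈ latticeEnsembles`, `δₖ → 0⁺`, and `X : Ω' → C` a presentation on a finite measure space of a sequential
`d_CN`-limit of the laws of `E.X δₖ` (`cnLawEDist E.P (E.X δₖ) ν X → 0`) with measurable exceptional events.  Then
for `ν`-a.e. `s` the configuration `X s` is locally finite: in every window finitely many loops of each type have
diameter `≥ ε` (`LoopConfig.IsLocallyFinite`).  Proof: an infinite such family contains, for every `M`, `M` loops
pairwise `θ`-separated (`Precompact.exists_separated_of_infinite`); by the key bound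
(`Precompact.measure_separated_le`, K1 `integral_ncard_bigLoops_le`) and continuity from below in `θ ↓ 0` this
has measure `≤ 2C((R+1)/(η/2))²/M` for every `M`, hence `0`; integer windows and diameters suffice. -/
theorem ae_isLocallyFinite_of_tendsto_cnLawEDist : ∀ E ∈ latticeEnsembles, ∀ (δs : ℕ → ℝ)
    {Ω' : Type} [MeasurableSpace Ω'] (ν : Measure Ω') [IsFiniteMeasure ν] (X : Ω' → LoopConfig ℂ),
    Tendsto δs atTop (𝓝[>] (0 : ℝ)) →
    (∀ (k : ℕ) (ε : ℝ), MeasurableSet {p : E.Ω × Ω' | LoopConfig.IsClose ε (E.X (δs k) p.1) (X p.2)}) →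
    Tendsto (fun k : ℕ ↦ LoopConfig.cnLawEDist E.P (E.X (δs k)) ν X) atTop (𝓝 0) →
    ∀ᵐ s ∂ν, (X s).IsLocallyFinite := by
  intro E hE δs Ω' _ ν _ X hδs hm h
  obtain ⟨C, c₀, hC, hc₀, hK1⟩ := integral_ncard_bigLoops_le E hE
  -- reduce to integer windows and diameters
  suffices hnat : ∀ (i : Fin 2) (N n : ℕ),
      ∀ᵐ s ∂ν, {u ∈ (X s).F i | u.range ⊆ ball (0 : ℂ) N ∧ (1 : ℝ) / (n + 1) ≤ diam u.range}.Finite by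
    have hall := ae_all_iff.2 fun i ↦ ae_all_iff.2 fun N ↦ ae_all_iff.2 fun n ↦ hnat i N n
    filter_upwards [hall] with s hs
    exact isLocallyFinite_of_nat hs
  intro i N n
  have hη : (0 : ℝ) < 1 / (n + 1) := by positivity
  have hη1 : (1 : ℝ) / (n + 1) ≤ 1 := by
    rw [div_le_one (by positivity)]
    linarith [(Nat.cast_nonneg n : (0 : ℝ) ≤ n)]
  set A : Ω' → Set (UnbasedLoop ℂ) := fun s ↦
    {u ∈ (X s).F i | u.range ⊆ ball (0 : ℂ) N ∧ (1 : ℝ) / (n + 1) ≤ diam u.range} with hA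
  set K₀ : ℝ := C * (((N : ℝ) + 1) / ((1 : ℝ) / (n + 1) / 2)) ^ 2 with hK₀
  have hK₀nn : 0 ≤ K₀ := by positivity
  -- the separated sets and their measure
  set S : ℝ → ℕ → Set Ω' := fun θ M ↦
    {s | ∃ F ⊆ A s, F.Finite ∧ M ≤ F.ncard ∧ F.Pairwise fun u v ↦ θ < u.udist v} with hS
  have hSle : ∀ θ : ℝ, 0 < θ → ∀ M : ℕ, 1 ≤ M → ν (S θ M) ≤ ENNReal.ofReal (2 * (K₀ / M)) := by
    intro θ hθ M hM
    have := measure_separated_le hE hδs ν hm h hC hc₀ hK1 i (Nat.cast_nonneg N) hη hη1 hθ hM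
    rwa [hK₀, ← mul_div_assoc] at *
  have hmono : ∀ M : ℕ, Monotone fun m : ℕ ↦ S (1 / ((m : ℝ) + 1)) M := by
    intro M m m' hmm' s hs
    obtain ⟨F, hF, hfin, hMF, hsep⟩ := hs
    refine ⟨F, hF, hfin, hMF, hsep.mono' fun u v huv ↦ lt_of_le_of_lt ?_ huv⟩
    gcongr
  have hU : ∀ M : ℕ, 1 ≤ M → ν (⋃ m : ℕ, S (1 / ((m : ℝ) + 1)) M) ≤ ENNReal.ofReal (2 * (K₀ / M)) := by
    intro M hM
    rw [(hmono M).measure_iUnion]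
    exact iSup_le fun m ↦ hSle _ (by positivity) M hM
  have hsub : ∀ M : ℕ, {s | (A s).Infinite} ⊆ ⋃ m : ℕ, S (1 / ((m : ℝ) + 1)) M := by
    intro M s hs
    obtain ⟨θ, hθ, F, hFA, hFfin, hMF, hsep⟩ := exists_separated_of_infinite hs M
    obtain ⟨m, hm⟩ := exists_nat_one_div_lt hθ
    exact Set.mem_iUnion.2 ⟨m, F, hFA, hFfin, hMF, hsep.mono' fun u v huv ↦ lt_trans hm huv⟩
  -- measure zero
  have h0 : ν {s | (A s).Infinite} = 0 := by
    refine le_antisymm (ENNReal.le_of_forall_pos_le_add fun κ hκ _ ↦ ?_) bot_le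
    rw [zero_add]
    have hκ' : (0 : ℝ) < κ := hκ
    obtain ⟨M, hM⟩ := exists_nat_gt (2 * K₀ / κ)
    have hMpos : (0 : ℝ) < M := lt_of_le_of_lt (by positivity) hM
    have hM1 : 1 ≤ M := Nat.one_le_iff_ne_zero.2 (by rintro rfl; simp at hMpos)
    have hlt : 2 * (K₀ / M) ≤ κ := by
      rw [div_lt_iff₀ hκ'] at hM
      rw [mul_div_assoc', div_le_iff₀ hMpos]
      linarith
    calc ν {s | (A s).Infinite} ≤ ν (⋃ m : ℕ, S (1 / ((m : ℝ) + 1)) M) := measure_mono (hsub M)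
      _ ≤ ENNReal.ofReal (2 * (K₀ / M)) := hU M hM1
      _ ≤ ENNReal.ofReal κ := ENNReal.ofReal_le_ofReal hlt
      _ = κ := ENNReal.ofReal_coe_nnreal
  rw [ae_iff]
  exact h0

/-- The same on the unit interval with Lebesgue measure (the frame of `PrecompactRegular`). -/
theorem ae_isLocallyFinite_unitInterval {E : LoopEnsemble} (hE : E ∈ latticeEnsembles) {δs : ℕ → ℝ}
    (hδs : Tendsto δs atTop (𝓝[>] (0 : ℝ))) {X : unitInterval → LoopConfig ℂ}
    (hm : ∀ (k : ℕ) (ε : ℝ), MeasurableSet {p : E.Ω × unitInterval | LoopConfig.IsClose ε (E.X (δs k) p.1) (X p.2)})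
    (h : Tendsto (fun k : ℕ ↦ LoopConfig.cnLawEDist E.P (E.X (δs k)) volume X) atTop (𝓝 0)) :
    ∀ᵐ s : unitInterval, (X s).IsLocallyFinite :=
  ae_isLocallyFinite_of_tendsto_cnLawEDist E hE δs volume X hδs hm h

end Summit.CriticalPhenomena.CardyFormulaZ2.Cruxes.NestingRigidity.PositiveConeWeightDoubling

end
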